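import Summits.BirchSwinnertonDyer.BirchSwinnertonDyer.Theses.ResidualThetaTransportAtTwo
import Summits.BirchSwinnertonDyer.BirchSwinnertonDyer.Theorems.ResidualThetaTransportAtTwoSignedMuPropagationAtTwoRSel2Transfer
import Summits.BirchSwinnertonDyer.BirchSwinnertonDyer.Theorems.ResidualThetaTransportAtTwoSignedMuVanishingAtTwoPlusSel2
import HarnessLib

/-!
# Route `ResidualThetaTransportAtTwo`: the crux `SignedMuPropagationAtTwoR` (stmt-BirchSwinnertonDyer-22891) PROVED —
# propagation of «X⁺ torsion ∧ μ = 0» at `2` along `W[2] ≃ A[2]` for `Δ_W < 0` (= stub `stub_propagationR` of line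
# `birth` v4 of Kμ⁺ stmt-20689)

Cell `bsd-wall`, width seat `bsd-wall-rtt-p4-w3`. The SEL2-TRANSFER at `2` (`Sel2TransferAtTwo.sel2Transfer`, assembled from
the sibling route's kernel-checked residual dévissage — lead bsd-wall-tp2-p1) fed into the reduction
`SignedMuAtTwo.signedMuPropagationAtTwoR_of_sel2Transfer` (width seat rtt-p4-w2, p580570). Greenberg–Vatsal Prop. (2.8) /
B. D. Kim Cor. 2.13, printed for odd `p`, here at `p = 2` for Kobayashi's `+` Selmer group on the habitat of the route
(good supersingular at `2`, `a₂ = 0`, `Δ_W < 0`). BSD is not proved by this; the seed child 21438 and the analytic inputs of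
Kμ⁺ remain. [cite: GreenbergVatsal2000, Prop. (2.8)] [cite: BDKim2009, Cor. 2.13]
-/

set_option autoImplicit false
set_option linter.dupNamespace false

noncomputable section

namespace Summit.BirchSwinnertonDyer.BirchSwinnertonDyer.Theorems

/-- **`SignedMuPropagationAtTwoR` holds** (item stmt-BirchSwinnertonDyer-22891): for globally minimal `W, A/ℚ` good
supersingular at `2` with `a₂ = 0`, `Δ_W < 0` and `W[2] ≃ A[2]` Galois-equivariantly, if every finitely generated `+`
signed Selmer dual of `A` over the cyclotomic `ℤ₂`-extension is torsion with `μ = 0`, then so is every finitely generated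
`+` signed Selmer dual of `W`. [cite: GreenbergVatsal2000, Prop. (2.8)] [cite: BDKim2009, Prop. 2.12 and Cor. 2.13] -/
theorem signedMuPropagationAtTwoR_proof :
    Summit.BirchSwinnertonDyer.BirchSwinnertonDyer.Theses.ResidualThetaTransportAtTwo.SignedMuPropagationAtTwoR :=
  SignedMuAtTwo.signedMuPropagationAtTwoR_of_sel2Transfer Sel2TransferAtTwo.sel2Transfer

end Summit.BirchSwinnertonDyer.BirchSwinnertonDyer.Theorems

end
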